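import Literature.AlgebraicGeometry.Resolution.BlowupsProduct
import Literature.AlgebraicGeometry.Resolution.AffineBlowupRegular
import Literature.AlgebraicGeometry.Resolution.BlowupsProperProofs
import Mathlib.Order.Filter.AtTopBot.Basic
import HarnessLib

/-!
# Composition of blow-ups is a blow-up (Raynaud; Temkin 2008, Lemma 2.1.4; Stacks 080B)

Topic: `Literature/AlgebraicGeometry/Resolution`. Last step of the decomposition of the named fact
`Temkin2008_prop234` (`Temkin2008Localization.lean`; Temkin 2008, Prop. 2.3.4): the proof of the
proposition was reduced in `Temkin2008LocalizationProofs.lean` (`temkin2008_prop234_of_comp`) to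
**Temkin's Lemma 2.1.4** in the Noetherian two-step form "a `T`-supported blow-up followed by a
`T`-supported blow-up is a `T`-supported blow-up" (arXiv p. 7: "A simple and natural proof of
this fact given in [RG] is incomplete, and we refer to [Con1] for a surprisingly involved full
proof due to Raynaud"; Stacks, Tag 080B, slogan "Composition of blowing ups is a blowing up").
This file PROVES it (`IsBlowup.exists_isBlowup_comp_supported`), for blow-ups in the sense of
the universal property (`IsBlowup`, Görtz–Wedhorn Def. 13.90), following the proof of Stacks
080B: with `𝓘_E = p⁻¹𝓟 𝒪_{Y'}` the exceptional ideal of `p : Y' → Y`, one finds `d` and an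
ideal `𝓡 ⊆ 𝒪_Y` with `p⁻¹𝓡 𝒪_{Y'} = 𝓟' · 𝓘_E^d`; then the blow-up `p'` of `Y'` along `𝓟'` is
also the blow-up along `𝓟' · 𝓘_E^d = p⁻¹𝓡 𝒪_{Y'}` (twisting by the effective Cartier divisor
`dE`), hence `p' ≫ p` is the blow-up of `Y` along `𝓟 · 𝓡` (Stacks 080A) — both steps landed in
`BlowupsProduct.lean` — and `Supp(𝓟𝓡) = Supp 𝓟 ∪ p(Supp 𝓟')`.

The heart is the existence of `d` and `𝓡` (the relative ampleness of `𝒪_{Y'}(1) = 𝓘_E`; in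
Stacks obtained from `divisors-lemma-closed-subscheme-proj-finite-type`), which is a computation
on the charts of `Proj ⨁ Iⁿ`:

* `exists_eventually_preimage_section`, `exists_mul_span_pow_eq_map_iInf_comap` — **the chart
  computation as pure algebra**: for ring maps `φᵢ : R → Bᵢ` with `I Bᵢ = (bᵢ)`, `bᵢ = φᵢ(gᵢ)`
  regular, every element of `Bᵢ` of the form `φᵢ(x)/bᵢᵐ`, transition elements
  `φⱼ(gᵢ) = uᵢⱼ bⱼ`, overlap rings `Bⱼ[1/uᵢⱼ]`, and ideals `𝔞ᵢ ⊆ Bᵢ` agreeing on overlaps, for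
  `d ≫ 0` every `𝔞ᵢ bᵢᵈ` is generated by the images of the elements of `R` landing in `𝔞ⱼ bⱼᵈ`
  on all charts ("`f = (aᵈm)/aᵈ = aᵈ(m/aᵈ)`" in the proof of 080B);
* `exists_mul_pow_reesChartBase_eq`, `reesChartBase_eq_isLocalizationElem_mul` — two facts on the
  affine blowup algebra `(R[It])_{(bt)}` (`AffineBlowup.lean`): every element is `a/bᵐ`,
  `a ∈ Iᵐ`; `c/1 = ((ct)/(bt)) · b/1`;
* the charts `D₊(xᵢt)` of `Bl_I(Spec R)`, `I = (x₁, …, x_r)`, inside Mathlib's `Proj` (local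
  notations `𝔚[i]`, `𝔢[i]`, `φ[i]`, `𝔲[i, j]`, `ρ[i, j]` for the chart, the identification of its
  sections with the affine blowup algebra, `φᵢ`, `uᵢⱼ`, the restriction): they cover
  (`iSup_genChart_eq_top`), their sections are the affine blowup algebras
  (`genChartIso_hom_genChartHom`), `D₊(xⱼt) ∩ D₊(xᵢt) = D(uᵢⱼ)` (`genChart_inf`, Mathlib's
  `Proj.awayι_preimage_basicOpen`), the exceptional ideal on `D₊(xᵢt)` is `(bᵢ)`
  (`exceptionalIdeal_genChart`);
* `affineBlowup.exists_idealSheaf_comap_eq_mul_pow` — **`π⁻¹(J₀~) 𝒪_{Bl} = 𝓚 · 𝓘_E^d` on the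
  model `Bl_I(Spec R)`** for an ideal sheaf `𝓚` of finite type on the charts;
* `IsBlowup.exists_comap_eq_mul_pow_of_isAffine` — the same for any blow-up (universal
  property) of an affine scheme along an ideal sheaf of finite type (uniqueness of blow-ups);
* `map_morphismRestrict_eq_comap` — pushforward of ideal sheaves (`IdealSheafData.map`) along a
  quasi-compact morphism commutes with restriction to opens of the target;
  `le_of_forall_comap_ι_le` — inequality of ideal sheaves is local;
* `IsBlowup.exists_comap_eq_mul_pow` — **for a blow-up `p` of a Noetherian scheme and any ideal
  sheaf `𝓚` upstairs, `p⁻¹𝓠 𝒪_{Y'} = 𝓚 · 𝓘_E^d` for some `d`, `𝓠`** (`𝓠 = p_*(𝓚𝓘_E^d) ∩ 𝒪_Y`);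
* `IsBlowup.exists_isBlowup_comp` — **Stacks 080B (Noetherian)**: `p' ≫ p` is a blow-up along
  some `𝓠` with `Supp 𝓠 ⊆ Supp 𝓟 ∪ p(Supp 𝓟')`;
* `IsBlowup.exists_isBlowup_comp_supported` — **Temkin's Lemma 2.1.4**, two-step Noetherian
  form = the hypothesis `hcomp` of `temkin2008_prop234_of_comp`.

## Faithfulness notes

* Temkin's Lemma 2.1.4 is stated for coherent (qcqs) `X` and arbitrary finite compositions; Stacks
  080B for qcqs `X` and centres of finite presentation. Proved here: Noetherian base, two
  blow-ups (finite compositions follow by induction; only the two-step case is used by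
  Prop. 2.3.4). Over a Noetherian base every ideal sheaf is of finite type and the largest
  candidate `𝓠 = p_*(𝓚𝓘_E^d) ∩ 𝒪_Y` works; the qcqs refinement (choosing a finite type `𝓠`)
  is not formalized.
* "`T`-supported" for the `Y`-scheme `Y'` means supported in the preimage of `T` (Temkin §2.1,
  p. 7: "given a morphism `g : X → S`, a closed subscheme `R ↪ S` … we say that `f` is
  `U`-admissible (or `R`-supported) if `f` is `g⁻¹(U)`-admissible"): `Supp P' ⊆ p⁻¹(T)`.

## Sources

* M. Temkin, *Desingularization of quasi-excellent schemes in characteristic zero*, Adv. Math.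
  219 (2008) 488–522 = arXiv:math/0703678, §2.1, Lemma 2.1.4 (p. 7); proof of Prop. 2.3.4
  (p. 12). [Temkin2008]
* The Stacks Project, Tag 080B (`divisors-lemma-composition-finite-type-blowups`) and its proof,
  Tag 080A (`divisors-lemma-blowing-up-two-ideals`), Tag 0804 (affine blowup algebras; the
  charts of `Proj` of the Rees algebra), Tag 02OS — read from `divisors.tex` of the Stacks
  project repository, labels ↔ tags from `tags/tags`. [StacksProject]
* U. Görtz, T. Wedhorn, *Algebraic Geometry I*, 2nd ed. (2020), Def. 13.90, Prop. 13.91,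
  Prop. 13.92. [GortzWedhorn2020]
-/

noncomputable section

open CategoryTheory CategoryTheory.Limits AlgebraicGeometry TopologicalSpace Opposite

namespace Literature.AlgebraicGeometry.Resolution

universe u

/-! ## The chart computation (pure algebra) -/

section Core

open Filter

variable {R : Type u} [CommRing R] {ι : Type*} (g : ι → R)
  {B : ι → Type u} [∀ i, CommRing (B i)] (φ : ∀ i, R →+* B i)
  {O : ι → ι → Type u} [∀ i j, CommRing (O i j)] [∀ i j, Algebra (B j) (O i j)]
  (u : ∀ i j : ι, B j) (ρ : ∀ i j, B i →+* O i j) (𝔞 : ∀ i, Ideal (B i))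

/-- **The chart computation behind the relative ampleness of `𝒪(1)` on a blowing up**, as pure
algebra. Data: ring maps `φᵢ : R → Bᵢ` (the charts `D₊(gᵢt)` of `Bl_I(Spec R)`, `I = (gᵢ)`),
with `bᵢ = φᵢ(gᵢ)`; every element of `Bᵢ` is `φᵢ(x)/bᵢᵐ` (`hF3`); `φⱼ(gᵢ) = uᵢⱼ bⱼ` and the
overlap ring `Oᵢⱼ = Bⱼ[1/uᵢⱼ]` receives `ρᵢⱼ : Bᵢ → Oᵢⱼ` compatibly with the `φ`'s; ideals
`𝔞ᵢ ⊆ Bᵢ` agreeing on overlaps (an ideal sheaf `𝓚`). Then for `y ∈ 𝔞ᵢ` and all large `d`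
there is `a ∈ R` with `φⱼ(a) ∈ 𝔞ⱼ bⱼᵈ` for all `j` and `φᵢ(a) = y bᵢᵈ` (namely
`a = x gᵢ^{d-m}` where `y bᵢᵐ = φᵢ(x)`): the section `y bᵢᵈ` of `𝓚 · 𝓘_E^d` comes from `R`.
(Stacks, Tag 080B, proof: "in the affine blowup algebra `A' = A[I/a]` we see that
`f = (a^d m)/a^d = a^d (m/a^d)`".) [cite: StacksProject, Tag 080B (proof)] -/
theorem exists_eventually_preimage_section [Finite ι]
    (hF3 : ∀ i (y : B i), ∃ (m : ℕ) (x : R), y * φ i (g i) ^ m = φ i x)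
    (hu : ∀ i j, φ j (g i) = u i j * φ j (g j))
    [hO : ∀ i j, IsLocalization.Away (u i j) (O i j)]
    (hρφ : ∀ i j (x : R), ρ i j (φ i x) = algebraMap (B j) (O i j) (φ j x))
    (hcompat : ∀ i j, (𝔞 i).map (ρ i j) ≤ (𝔞 j).map (algebraMap (B j) (O i j)))
    (i : ι) {y : B i} (hy : y ∈ 𝔞 i) :
    ∀ᶠ d in atTop, ∃ a : R, (∀ j, φ j a ∈ 𝔞 j * Ideal.span {φ j (g j) ^ d}) ∧
      φ i a = y * φ i (g i) ^ d := by
  obtain ⟨m, x, hx⟩ := hF3 i y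
  -- on the overlap with chart `j`, `φⱼ(x)` lies in `𝔞ⱼ bⱼᵐ`, hence `uᵢⱼ^N φⱼ(x) ∈ 𝔞ⱼ bⱼᵐ`
  have hN : ∀ j, ∃ N : ℕ, u i j ^ N * φ j x ∈ 𝔞 j * Ideal.span {φ j (g j) ^ m} := by
    intro j
    have h1 : algebraMap (B j) (O i j) (φ j x) ∈
        (𝔞 j * Ideal.span {φ j (g j) ^ m}).map (algebraMap (B j) (O i j)) := by
      have e : algebraMap (B j) (O i j) (φ j x) = (ρ i j y * algebraMap (B j) (O i j) (u i j) ^ m) *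
          algebraMap (B j) (O i j) (φ j (g j) ^ m) := by
        rw [← hρφ i j x, ← hx, map_mul, map_pow, hρφ i j (g i), hu i j, map_mul, mul_pow, map_pow]
        ring
      rw [e, Ideal.map_mul, Ideal.map_span, Set.image_singleton]
      refine Ideal.mul_mem_mul ?_ (Ideal.mem_span_singleton_self _)
      exact Ideal.mul_mem_right _ _ (hcompat i j (Ideal.mem_map_of_mem _ hy))
    obtain ⟨⟨z, ⟨_, k, rfl⟩⟩, hz⟩ :=
      (IsLocalization.mem_map_algebraMap_iff (.powers (u i j)) (O i j)).mp h1
    have h2 : algebraMap (B j) (O i j) (φ j x * u i j ^ k - z) = 0 := by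
      rw [map_sub, map_mul, sub_eq_zero]
      exact hz
    obtain ⟨⟨_, c, rfl⟩, hc⟩ := (IsLocalization.map_eq_zero_iff (.powers (u i j)) (O i j) _).mp h2
    refine ⟨c + k, ?_⟩
    have : u i j ^ (c + k) * φ j x = u i j ^ c * z := by
      rw [mul_sub, sub_eq_zero] at hc
      rw [pow_add, mul_assoc, mul_comm (u i j ^ k), hc]
    rw [this]
    exact Ideal.mul_mem_left _ _ z.2
  choose N hN using hN
  have hev : ∀ᶠ d in atTop, ∀ j, m + N j ≤ d :=
    eventually_all.mpr fun j => eventually_ge_atTop (m + N j)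
  refine hev.mono fun d hd => ⟨x * g i ^ (d - m), fun j => ?_, ?_⟩
  · obtain ⟨z, hz𝔞, hz⟩ := Ideal.mem_mul_span_singleton.mp (hN j)
    have e1 : φ j (g j) ^ d = φ j (g j) ^ m * φ j (g j) ^ (d - m) := by
      rw [← pow_add]; congr 1; have := hd j; omega
    have e2 : u i j ^ (d - m) = u i j ^ N j * u i j ^ (d - m - N j) := by
      rw [← pow_add]; congr 1; have := hd j; omega
    rw [Ideal.mem_mul_span_singleton]
    refine ⟨z * u i j ^ (d - m - N j), Ideal.mul_mem_right _ _ hz𝔞, ?_⟩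
    calc z * u i j ^ (d - m - N j) * φ j (g j) ^ d
        = (z * φ j (g j) ^ m) * (u i j ^ (d - m - N j) * φ j (g j) ^ (d - m)) := by rw [e1]; ring
      _ = u i j ^ N j * φ j x * (u i j ^ (d - m - N j) * φ j (g j) ^ (d - m)) := by rw [hz]
      _ = φ j x * ((u i j ^ N j * u i j ^ (d - m - N j)) * φ j (g j) ^ (d - m)) := by ring
      _ = φ j (x * g i ^ (d - m)) := by rw [← e2, ← mul_pow, ← hu, ← map_pow, ← map_mul]
  · have hdm : m + (d - m) = d := by have := hd i; omega
    rw [map_mul, map_pow, ← hx, mul_assoc, ← pow_add, hdm]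

/-- `φᵢ` maps the ideal of `R` of elements landing in `𝔞ⱼ bⱼᵈ` on every chart into `𝔞ᵢ bᵢᵈ`.
[folklore] -/
theorem map_iInf_comap_le (d : ℕ) (i : ι) :
    (⨅ j, (𝔞 j * Ideal.span {φ j (g j) ^ d}).comap (φ j)).map (φ i) ≤
      𝔞 i * Ideal.span {φ i (g i) ^ d} := by
  rw [Ideal.map_le_iff_le_comap]
  exact iInf_le (fun j => (𝔞 j * Ideal.span {φ j (g j) ^ d}).comap (φ j)) i

/-- **For `d ≫ 0`, on every chart `𝔞ᵢ bᵢᵈ` is generated by the images of the elements of `R`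
that land in `𝔞ⱼ bⱼᵈ` on all charts** (finitely many charts, finitely generated `𝔞ᵢ`): the
algebraic content of "`p⁻¹𝓙 𝒪_{X'} = 𝓘_E^d 𝓘_{Z'}`" in the proof of Stacks, Tag 080B.
[cite: StacksProject, Tag 080B (proof)] -/
theorem exists_mul_span_pow_eq_map_iInf_comap [Finite ι]
    (hF3 : ∀ i (y : B i), ∃ (m : ℕ) (x : R), y * φ i (g i) ^ m = φ i x)
    (hu : ∀ i j, φ j (g i) = u i j * φ j (g j))
    [hO : ∀ i j, IsLocalization.Away (u i j) (O i j)]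
    (hρφ : ∀ i j (x : R), ρ i j (φ i x) = algebraMap (B j) (O i j) (φ j x))
    (hcompat : ∀ i j, (𝔞 i).map (ρ i j) ≤ (𝔞 j).map (algebraMap (B j) (O i j)))
    (h𝔞 : ∀ i, (𝔞 i).FG) :
    ∃ d : ℕ, ∀ i, 𝔞 i * Ideal.span {φ i (g i) ^ d} =
      (⨅ j, (𝔞 j * Ideal.span {φ j (g j) ^ d}).comap (φ j)).map (φ i) := by
  classical
  choose S hS using h𝔞
  have key : ∀ᶠ d in atTop, ∀ i, ∀ y ∈ S i, ∃ a : R,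
      (∀ j, φ j a ∈ 𝔞 j * Ideal.span {φ j (g j) ^ d}) ∧ φ i a = y * φ i (g i) ^ d := by
    refine eventually_all.mpr fun i => (eventually_all_finset (S i)).mpr fun y hy => ?_
    exact exists_eventually_preimage_section g φ u ρ 𝔞 hF3 hu hρφ hcompat i
      (hS i ▸ Ideal.subset_span hy)
  obtain ⟨d, hd⟩ := key.exists
  refine ⟨d, fun i => le_antisymm ?_ (map_iInf_comap_le g φ 𝔞 d i)⟩
  rw [← hS i, Ideal.span_mul_span', Ideal.span_le]
  rintro _ ⟨y, hy, _, rfl, rfl⟩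
  obtain ⟨a, ha, hai⟩ := hd i y hy
  rw [SetLike.mem_coe, show (fun x1 x2 : B i => x1 * x2) y (φ i (g i) ^ d) = y * φ i (g i) ^ d from rfl,
    ← hai]
  refine Ideal.mem_map_of_mem _ ?_
  simp only [Ideal.mem_iInf, Ideal.mem_comap]
  exact ha

end Core

/-! ## Two more facts about the affine blowup algebra `(R[It])_{(bt)}` -/

section Honest

open HomogeneousLocalization Polynomial

variable {R : Type u} [CommRing R] {I : Ideal R} (b : R) (hb : b ∈ I)

/-- **Every element of the affine blowup algebra `R[I/b] = (R[It])_{(bt)}` is `a/bᵐ` with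
`a ∈ Iᵐ`**: for `y = (a tᵐ)/(b t)ᵐ` one has `y · (b/1)ᵐ = a/1`. [cite: StacksProject, Tag 0804] -/
theorem exists_mul_pow_reesChartBase_eq (y : Away (reesGrading I) (reesT b hb)) :
    ∃ (m : ℕ) (a : R), y * reesChartBase b hb b ^ m = reesChartBase b hb a := by
  obtain ⟨m, p, hp, rfl⟩ := HomogeneousLocalization.Away.mk_surjective (reesGrading I) (reesT_mem b hb) y
  obtain ⟨a, ha⟩ := hp
  have ha' : (p : R[X]) = monomial (m • 1) a := ha.symm
  refine ⟨m, a, ?_⟩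
  apply HomogeneousLocalization.val_injective
  rw [HomogeneousLocalization.val_mul, HomogeneousLocalization.val_pow,
    HomogeneousLocalization.Away.val_mk, val_reesChartBase_eq_mk, val_reesChartBase_eq_mk,
    Localization.mk_pow, Localization.mk_mul, Localization.mk_eq_mk_iff, Localization.r_iff_exists]
  refine ⟨1, Subtype.ext ?_⟩
  simp only [OneMemClass.coe_one, one_mul, SubmonoidClass.coe_pow, Subalgebra.coe_mul, coe_reesT,
    ha', Subalgebra.coe_algebraMap, ← Polynomial.C_eq_algebraMap, monomial_pow, monomial_mul_C,
    smul_eq_mul, mul_one, one_pow]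
  rw [← C_pow, monomial_mul_C, mul_comm a]

/-- The transition element `u = (c t)/(b t)` of two charts: `c/1 = u · b/1` in `(R[It])_{(bt)}`
(Mathlib's `Away.isLocalizationElem`, along which `D₊(bt) ∩ D₊(ct) = D(u) ⊆ D₊(bt)`).
[cite: StacksProject, Tag 0804] -/
theorem reesChartBase_eq_isLocalizationElem_mul (c : R) (hc : c ∈ I) :
    reesChartBase b hb c =
      Away.isLocalizationElem (reesT_mem b hb) (reesT_mem c hc) * reesChartBase b hb b := by
  apply HomogeneousLocalization.val_injective
  rw [HomogeneousLocalization.val_mul, val_reesChartBase_eq_mk, val_reesChartBase_eq_mk,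
    HomogeneousLocalization.Away.val_mk, Localization.mk_mul, Localization.mk_eq_mk_iff,
    Localization.r_iff_exists]
  refine ⟨1, Subtype.ext ?_⟩
  simp only [OneMemClass.coe_one, one_mul, Subalgebra.coe_mul, coe_reesT, Subalgebra.coe_algebraMap,
    ← Polynomial.C_eq_algebraMap, monomial_mul_C, pow_one, mul_one]
  rw [mul_comm]

end Honest

/-! ## The charts of `Bl_I(Spec R)` at a system of generators -/

section Model

open HomogeneousLocalization Polynomial

variable {R : Type u} [CommRing R] {r : ℕ} (x : Fin r → R)

local notation3 "I" => Ideal.span (Set.range x)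

/-- The chart `D₊(x_i t)` of `Bl_I(Spec R)` as an affine open (notation `𝔚[i]`). -/
local notation3 "𝔚[" i "]" => (affineBlowup.chartOpen (x i) (Ideal.mem_span_range_self (f := x) (x := i)) :
  (affineBlowup (Ideal.span (Set.range x))).affineOpens)

/-- The sections over the chart `D₊(x_i t)` are the affine blowup algebra
`(R[It])_{(x_i t)} = R[I/x_i]` (notation `𝔢[i]` for the isomorphism). -/
local notation3 "𝔢[" i "]" => (@id (Γ(affineBlowup (Ideal.span (Set.range x)),
    (affineBlowup.chartOpen (x i) (Ideal.mem_span_range_self (f := x) (x := i)) : (affineBlowup (Ideal.span (Set.range x))).affineOpens)) ≅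
      CommRingCat.of (HomogeneousLocalization.Away (reesGrading (Ideal.span (Set.range x)))
        (reesT (x i) (Ideal.mem_span_range_self (f := x) (x := i)))))
  ((affineBlowup.chartι (x i) (Ideal.mem_span_range_self (f := x) (x := i))).appIso ⊤ ≪≫ Scheme.ΓSpecIso (CommRingCat.of
    (HomogeneousLocalization.Away (reesGrading (Ideal.span (Set.range x))) (reesT (x i) (Ideal.mem_span_range_self (f := x) (x := i)))))))

/-- The ring map `φ_i : R → Γ(Bl, D₊(x_i t))` induced by `π : Bl → Spec R` (notation `φ[i]`). -/
local notation3 "φ[" i "]" => (((affineBlowup.π (Ideal.span (Set.range x))).appLE ⊤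
  (affineBlowup.chartOpen (x i) (Ideal.mem_span_range_self (f := x) (x := i)) : (affineBlowup (Ideal.span (Set.range x))).affineOpens)
    le_top).hom.comp (Scheme.ΓSpecIso (CommRingCat.of R)).inv.hom)

/-- The transition section `u_{ij} = (x_i t)/(x_j t) ∈ Γ(Bl, D₊(x_j t))` (notation `𝔲[i, j]`). -/
local notation3 "𝔲[" i ", " j "]" => ((𝔢[j]).inv
    (HomogeneousLocalization.Away.isLocalizationElem (reesT_mem (x j) (Ideal.mem_span_range_self (f := x) (x := j)))
      (reesT_mem (x i) (Ideal.mem_span_range_self (f := x) (x := i)))))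

/-- The charts at the generators cover the blowing up. [cite: StacksProject, Tag 0804] -/
theorem iSup_genChart_eq_top : ⨆ i, (𝔚[i] : (affineBlowup I).Opens) = ⊤ := by
  rw [← affineBlowup.iSup_basicOpen_reesT_generators_eq_top x]
  congr 1
  ext i : 1
  exact affineBlowup.image_top_chartι (x i) (Ideal.mem_span_range_self (f := x) (x := i))

/-- Under `Γ(Bl, D₊(x_i t)) ≅ (R[It])_{(x_i t)}`, `φ_i` is the structure map `r ↦ r/1`.
[folklore] -/
theorem genChartIso_hom_genChartHom (i : Fin r) (a : R) :
    (𝔢[i]).hom (φ[i] a) = reesChartBase (x i) (Ideal.mem_span_range_self (f := x) (x := i)) a := by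
  have h1 : (affineBlowup.π I).appLE ⊤ (affineBlowup.chartι (x i) (Ideal.mem_span_range_self (f := x) (x := i)) ''ᵁ ⊤) le_top ≫
      (affineBlowup.chartι (x i) (Ideal.mem_span_range_self (f := x) (x := i))).appLE (affineBlowup.chartι (x i) (Ideal.mem_span_range_self (f := x) (x := i)) ''ᵁ ⊤)
        ⊤ ((affineBlowup.chartι (x i) (Ideal.mem_span_range_self (f := x) (x := i))).preimage_image_eq ⊤).ge =
      (Spec.map (CommRingCat.ofHom (reesChartBase (x i) (Ideal.mem_span_range_self (f := x) (x := i))))).appTop := by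
    rw [Scheme.Hom.appLE_comp_appLE]
    have : ∀ (f : _ ⟶ Spec (.of R))
        (_ : f = Spec.map (CommRingCat.ofHom (reesChartBase (x i) (Ideal.mem_span_range_self (f := x) (x := i))))) (e),
        f.appLE ⊤ ⊤ e =
          (Spec.map (CommRingCat.ofHom (reesChartBase (x i) (Ideal.mem_span_range_self (f := x) (x := i))))).appTop := by
      rintro _ rfl e
      exact Scheme.Hom.appLE_eq_app _
    exact this _ (affineBlowup.chartι_π (x i) (Ideal.mem_span_range_self (f := x) (x := i))) _
  have h2 : (Scheme.ΓSpecIso (.of R)).inv ≫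
      (affineBlowup.π I).appLE ⊤ (affineBlowup.chartι (x i) (Ideal.mem_span_range_self (f := x) (x := i)) ''ᵁ ⊤) le_top ≫
        ((affineBlowup.chartι (x i) (Ideal.mem_span_range_self (f := x) (x := i))).appIso ⊤).hom ≫ (Scheme.ΓSpecIso _).hom =
      CommRingCat.ofHom (reesChartBase (x i) (Ideal.mem_span_range_self (f := x) (x := i))) := by
    rw [Scheme.Hom.appIso_hom', reassoc_of% h1, Scheme.ΓSpecIso_naturality, Iso.inv_hom_id_assoc]
  exact congrArg (fun f : CommRingCat.of R ⟶ _ => f.hom a) h2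

/-- Conversely, `Γ(Bl, D₊(x_i t)) ≅ (R[It])_{(x_i t)}` takes `r/1` to `φ_i(r)`. [folklore] -/
theorem genChartIso_inv_reesChartBase (i : Fin r) (a : R) :
    (𝔢[i]).inv (reesChartBase (x i) (Ideal.mem_span_range_self (f := x) (x := i)) a) = φ[i] a := by
  rw [← genChartIso_hom_genChartHom, ← CommRingCat.comp_apply, Iso.hom_inv_id]
  rfl

/-- `φ_i` is `r ↦ r/1` followed by the isomorphism. [folklore] -/
theorem genChartHom_eq_comp (i : Fin r) :
    φ[i] = (𝔢[i]).inv.hom.comp (reesChartBase (x i) (Ideal.mem_span_range_self (f := x) (x := i))) :=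
  RingHom.ext fun a => (genChartIso_inv_reesChartBase x i a).symm

/-- **`b_i = φ_i(x_i)` is a nonzerodivisor of `Γ(Bl, D₊(x_i t))`.** [cite: StacksProject, Tag 0804] -/
theorem genChartHom_gen_mem_nonZeroDivisors (i : Fin r) :
    φ[i] (x i) ∈ nonZeroDivisors Γ(affineBlowup I, 𝔚[i]) := by
  rw [← genChartIso_inv_reesChartBase]
  exact mem_nonZeroDivisors_of_inverse (𝔢[i]).inv.hom (𝔢[i]).hom.hom
    (fun a => by
      change ((𝔢[i]).inv ≫ (𝔢[i]).hom).hom a = a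
      rw [Iso.inv_hom_id]; rfl)
    (fun a => by
      change ((𝔢[i]).hom ≫ (𝔢[i]).inv).hom a = a
      rw [Iso.hom_inv_id]; rfl)
    (reesChartBase_mem_nonZeroDivisors (x i) (Ideal.mem_span_range_self (f := x) (x := i)))

/-- **On the chart `D₊(x_i t)` the ideal `I` is generated by `b_i = φ_i(x_i)`.**
[cite: StacksProject, Tag 0804] -/
theorem map_genChartHom_eq_span (i : Fin r) :
    (Ideal.span (Set.range x)).map (φ[i]) = Ideal.span {φ[i] (x i)} := by
  rw [genChartHom_eq_comp, ← Ideal.map_map, map_reesChartBase_eq, Ideal.map_span,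
    Set.image_singleton]
  rfl

/-- **Every section of `Bl` over `D₊(x_i t)` is `φ_i(a)/b_iᵐ`.** [cite: StacksProject, Tag 0804] -/
theorem exists_mul_pow_genChartHom_eq (i : Fin r) (y : Γ(affineBlowup I, 𝔚[i])) :
    ∃ (m : ℕ) (a : R), y * φ[i] (x i) ^ m = φ[i] a := by
  obtain ⟨m, a, h⟩ := exists_mul_pow_reesChartBase_eq (x i) (Ideal.mem_span_range_self (f := x) (x := i)) ((𝔢[i]).hom y)
  refine ⟨m, a, ?_⟩
  have hinj : Function.Injective (𝔢[i]).hom := (ConcreteCategory.bijective_of_isIso _).1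
  apply hinj
  rw [map_mul, map_pow, genChartIso_hom_genChartHom, genChartIso_hom_genChartHom]
  exact h

/-- `φ_j(x_i) = u_{ij} · b_j`. [cite: StacksProject, Tag 0804] -/
theorem genChartHom_eq_genU_mul (i j : Fin r) :
    φ[j] (x i) = 𝔲[i, j] * φ[j] (x j) := by
  rw [← genChartIso_inv_reesChartBase, reesChartBase_eq_isLocalizationElem_mul (x j) (Ideal.mem_span_range_self (f := x) (x := j))
    (x i) (Ideal.mem_span_range_self (f := x) (x := i)), map_mul, genChartIso_inv_reesChartBase]

/-- **The overlap of two charts is the basic open of the transition section**: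
`D₊(x_j t) ∩ D₊(x_i t) = D(u_{ij}) ⊆ D₊(x_j t)`. [cite: StacksProject, Tag 0804] -/
theorem genChart_inf (i j : Fin r) :
    (𝔚[j] : (affineBlowup I).Opens) ⊓ 𝔚[i] = (affineBlowup I).basicOpen (𝔲[i, j]) := by
  have h1 : (𝔚[i] : (affineBlowup I).Opens) =
      Proj.basicOpen (reesGrading I) (reesT (x i) (Ideal.mem_span_range_self (f := x) (x := i))) :=
    affineBlowup.image_top_chartι (x i) (Ideal.mem_span_range_self (f := x) (x := i))
  have h2 : (𝔚[j] : (affineBlowup I).Opens) =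
      (affineBlowup.chartι (x j) (Ideal.mem_span_range_self (f := x) (x := j))).opensRange :=
    Scheme.Hom.image_top_eq_opensRange _
  have h3 : affineBlowup.chartι (x j) (Ideal.mem_span_range_self (f := x) (x := j)) ⁻¹ᵁ
      Proj.basicOpen (reesGrading I) (reesT (x i) (Ideal.mem_span_range_self (f := x) (x := i))) =
        (Spec (.of (Away (reesGrading I) (reesT (x j) (Ideal.mem_span_range_self (f := x) (x := j)))))).basicOpen
          ((Scheme.ΓSpecIso (.of (Away (reesGrading I) (reesT (x j) (Ideal.mem_span_range_self (f := x) (x := j)))))).inv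
            (Away.isLocalizationElem (reesT_mem (x j) (Ideal.mem_span_range_self (f := x) (x := j)))
              (reesT_mem (x i) (Ideal.mem_span_range_self (f := x) (x := i))))) :=
    (Proj.awayι_preimage_basicOpen (reesGrading I) (reesT_mem (x j) (Ideal.mem_span_range_self (f := x) (x := j))) one_pos
      (reesT_mem (x i) (Ideal.mem_span_range_self (f := x) (x := i))) one_pos).trans
      (basicOpen_eq_of_affine (R := .of (Away (reesGrading I) (reesT (x j) (Ideal.mem_span_range_self (f := x) (x := j)))))
        (Away.isLocalizationElem (reesT_mem (x j) (Ideal.mem_span_range_self (f := x) (x := j)))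
          (reesT_mem (x i) (Ideal.mem_span_range_self (f := x) (x := i))))).symm
  conv_lhs => rw [h2, h1]
  rw [← Scheme.Hom.image_preimage_eq_opensRange_inf, h3, Scheme.image_basicOpen]
  rfl

/-- `D(u_{ij}) ⊆ D₊(x_i t)`. [folklore] -/
theorem basicOpen_genU_le (i j : Fin r) :
    (affineBlowup I).basicOpen (𝔲[i, j]) ≤ (𝔚[i] : (affineBlowup I).Opens) := by
  rw [← genChart_inf]
  exact inf_le_right

/-- The restriction `Γ(Bl, D₊(x_i t)) → Γ(Bl, D(u_{ij}))` (notation `ρ[i, j]`). -/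
local notation3 (prettyPrint := false) "ρ[" i ", " j "]" =>
  (((affineBlowup (Ideal.span (Set.range x))).presheaf.map (homOfLE (basicOpen_genU_le x i j)).op).hom)

/-- The two routes `R → Γ(Bl, D(u_{ij}))` agree. [folklore] -/
theorem genRes_genChartHom (i j : Fin r) (a : R) :
    ρ[i, j] (φ[i] a) =
      algebraMap Γ(affineBlowup I, 𝔚[j]) _ (φ[j] a) := by
  change ((affineBlowup.π I).appLE ⊤ (𝔚[i]) le_top ≫ (affineBlowup I).presheaf.map _)
      ((Scheme.ΓSpecIso (.of R)).inv a) =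
    ((affineBlowup.π I).appLE ⊤ (𝔚[j]) le_top ≫ (affineBlowup I).presheaf.map _)
      ((Scheme.ΓSpecIso (.of R)).inv a)
  rw [Scheme.Hom.appLE_map, Scheme.Hom.appLE_map]

/-- The exceptional ideal on the chart `D₊(x_i t)` is generated by `b_i`. [cite: StacksProject, Tag 02OS] -/
theorem exceptionalIdeal_genChart (i : Fin r) :
    (affineBlowup.exceptionalIdeal I).ideal (𝔚[i]) = Ideal.span {φ[i] (x i)} := by
  rw [affineBlowup.exceptionalIdeal, ideal_comap_of_le (affineBlowup.π I) _ ⟨⊤, isAffineOpen_top _⟩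
    (𝔚[i]) le_top, affineBlowup.idealSheaf, ideal_ofIdealTop_top, Ideal.map_map,
    ← map_genChartHom_eq_span]

/-- **Relative ampleness of `𝒪(1)` on `Bl_I(Spec R)`, `I = (x_1, …, x_r)`**: for an ideal sheaf
`𝓚` on the blowing up, of finite type on the charts, there are `d` and an ideal `J₀ ⊆ R` with
`π⁻¹(J₀~) 𝒪_{Bl} = 𝓚 · 𝓘_E^d` — the displayed formula "`b⁻¹𝓙 𝒪_{X'} = 𝓘_E^d 𝓘_{Z'}`" in the
proof of Stacks, Tag 080B (there obtained from `divisors-lemma-closed-subscheme-proj-finite-type`;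
here `J₀` is the ideal of elements landing in `𝓚(D₊(x_j t)) b_jᵈ` on every chart, and the
equality is the chart computation `exists_mul_span_pow_eq_map_iInf_comap`).
[cite: StacksProject, Tag 080B (proof)] -/
theorem affineBlowup.exists_idealSheaf_comap_eq_mul_pow (K : (affineBlowup I).IdealSheafData)
    (hK : ∀ i, (K.ideal (𝔚[i])).FG) :
    ∃ (d : ℕ) (J₀ : Ideal R), (affineBlowup.idealSheaf J₀).comap (affineBlowup.π I) =
      K * affineBlowup.exceptionalIdeal I ^ d := by
  have hcompat : ∀ i j, (K.ideal (𝔚[i])).map (ρ[i, j]) ≤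
      (K.ideal (𝔚[j])).map (algebraMap Γ(affineBlowup I, 𝔚[j])
        Γ(affineBlowup I, (affineBlowup I).basicOpen (𝔲[i, j]))) := fun i j => by
    have e1 := K.map_ideal (U := (affineBlowup I).affineBasicOpen (𝔲[i, j])) (V := 𝔚[i])
      (basicOpen_genU_le x i j)
    have e2 := K.map_ideal (U := (affineBlowup I).affineBasicOpen (𝔲[i, j])) (V := 𝔚[j])
      ((affineBlowup I).basicOpen_le (𝔲[i, j]))
    exact (e1.trans e2.symm).le
  obtain ⟨d, hd⟩ := exists_mul_span_pow_eq_map_iInf_comap x (fun i => φ[i])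
    (O := fun i j => Γ(affineBlowup I, (affineBlowup I).basicOpen (𝔲[i, j]))) (fun i j => 𝔲[i, j])
    (fun i j => ρ[i, j]) (fun i => K.ideal (𝔚[i])) (exists_mul_pow_genChartHom_eq x)
    (genChartHom_eq_genU_mul x) (hO := fun i j => (𝔚[j]).2.isLocalization_basicOpen (𝔲[i, j]))
    (genRes_genChartHom x) hcompat hK
  refine ⟨d, ⨅ j, (K.ideal (𝔚[j]) * Ideal.span {φ[j] (x j) ^ d}).comap φ[j], ?_⟩
  refine Scheme.IdealSheafData.ext_of_iSup_eq_top (fun i => 𝔚[i]) (iSup_genChart_eq_top x)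
    fun i => ?_
  rw [ideal_comap_of_le (affineBlowup.π I) _ ⟨⊤, isAffineOpen_top _⟩ (𝔚[i]) le_top,
    affineBlowup.idealSheaf, ideal_ofIdealTop_top, Ideal.map_map, Scheme.IdealSheafData.ideal_mul,
    Scheme.IdealSheafData.ideal_pow, Pi.mul_apply, Pi.pow_apply, exceptionalIdeal_genChart,
    Ideal.span_singleton_pow, hd i]

end Model

/-! ## Transport to blowing ups in the sense of the universal property -/

section Transport

/-- **Relative ampleness of the exceptional divisor, for a blowing up of an affine scheme** in
the sense of the universal property (`IsBlowup`), along an ideal sheaf of finite type, and an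
ideal sheaf `𝓚` of finite type upstairs: `p⁻¹𝓠 𝒪_{Y'} = 𝓚 · 𝓘_E^d` for some `d` and some ideal
sheaf `𝓠` on the base. (From the model `Bl_{I₀}(Spec Γ(Y, 𝒪_Y))`,
`affineBlowup.exists_idealSheaf_comap_eq_mul_pow`, through the uniqueness of blowing ups.)
[cite: StacksProject, Tag 080B (proof)] -/
theorem IsBlowup.exists_comap_eq_mul_pow_of_isAffine {Y' Y : Scheme.{u}} [IsAffine Y]
    {p : Y' ⟶ Y} {P : Y.IdealSheafData} (hp : IsBlowup p P)
    (hP : ∀ U : Y.affineOpens, (P.ideal U).FG) (K : Y'.IdealSheafData)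
    (hK : ∀ U : Y'.affineOpens, (K.ideal U).FG) :
    ∃ (d : ℕ) (Q : Y.IdealSheafData), Q.comap p = K * P.comap p ^ d := by
  let e := Y.isoSpec
  let K₀ : (Spec Γ(Y, ⊤)).IdealSheafData := P.comap e.inv
  have h1 : IsBlowup (p ≫ e.hom) K₀ := hp.comp_iso e
  have hsurj : Function.Surjective (Scheme.ΓSpecIso Γ(Y, ⊤)).inv.hom :=
    (Scheme.ΓSpecIso Γ(Y, ⊤)).symm.commRingCatIsoToRingEquiv.surjective
  let J : Ideal Γ(Spec Γ(Y, ⊤), ⊤) := K₀.ideal ⟨⊤, isAffineOpen_top _⟩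
  let I₀ : Ideal Γ(Y, ⊤) := J.comap (Scheme.ΓSpecIso Γ(Y, ⊤)).inv.hom
  have hK₀' : Scheme.IdealSheafData.ofIdealTop J = K₀ := by
    apply Scheme.IdealSheafData.ext_of_isAffine
    rw [ideal_ofIdealTop_top]
  have hJ : J = ((P.ideal ⟨e.inv ''ᵁ ⊤, (isAffineOpen_top _).image_of_isOpenImmersion e.inv⟩).comap
      (e.inv.appIso ⊤).inv.hom) := by
    show (P.comap e.inv).ideal ⟨⊤, isAffineOpen_top _⟩ = _
    rw [Scheme.IdealSheafData.ideal_comap_of_isOpenImmersion]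
  have hI₀ : I₀.FG := by
    show (J.comap (Scheme.ΓSpecIso Γ(Y, ⊤)).inv.hom).FG
    rw [hJ]
    refine Ideal.fg_comap_of_iso (Scheme.ΓSpecIso Γ(Y, ⊤)).symm ?_
    exact Ideal.fg_comap_of_iso (e.inv.appIso ⊤).symm (hP _)
  obtain ⟨n, x, hx⟩ := Submodule.fg_iff_exists_fin_generating_family.mp hI₀
  have hK₀ : affineBlowup.idealSheaf (Ideal.span (Set.range x)) = K₀ := by
    rw [← hK₀', affineBlowup.idealSheaf]
    change Scheme.IdealSheafData.ofIdealTop ((Ideal.span (Set.range x)).map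
      (Scheme.ΓSpecIso Γ(Y, ⊤)).inv.hom) = _
    rw [show Ideal.span (Set.range x) = I₀ from hx, Ideal.map_comap_of_surjective _ hsurj]
  -- the model blowing up and the comparison isomorphism `φ : Y' ≅ Bl` over `Spec Γ(Y, 𝒪_Y)`
  have h2 : IsBlowup (affineBlowup.π (Ideal.span (Set.range x))) K₀ :=
    hK₀ ▸ affineBlowup.isBlowup _
  obtain ⟨φ, hφ, -⟩ := h1.unique h2
  -- move `K` to the model, where it is of finite type on the charts
  have hK' : ∀ i, ((K.comap φ.inv).ideal (affineBlowup.chartOpen (x i) (Ideal.mem_span_range_self (f := x) (x := i)))).FG :=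
      fun i => by
    rw [Scheme.IdealSheafData.ideal_comap_of_isOpenImmersion]
    exact Ideal.fg_comap_of_iso (φ.inv.appIso _).symm (hK _)
  obtain ⟨d, J₁, hJ₁⟩ := affineBlowup.exists_idealSheaf_comap_eq_mul_pow x (K.comap φ.inv) hK'
  refine ⟨d, (affineBlowup.idealSheaf J₁).comap e.hom, ?_⟩
  -- and pull the identity back along `φ.hom`
  have hE : (affineBlowup.exceptionalIdeal (Ideal.span (Set.range x))).comap φ.hom = P.comap p := by
    rw [affineBlowup.exceptionalIdeal, ← Scheme.IdealSheafData.comap_comp, hφ, hK₀]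
    change (P.comap e.inv).comap (p ≫ e.hom) = _
    rw [← Scheme.IdealSheafData.comap_comp, Category.assoc, e.hom_inv_id, Category.comp_id]
  have hKK : (K.comap φ.inv).comap φ.hom = K := by
    rw [← Scheme.IdealSheafData.comap_comp, φ.hom_inv_id, Scheme.IdealSheafData.comap_id]
  calc ((affineBlowup.idealSheaf J₁).comap e.hom).comap p
      = (affineBlowup.idealSheaf J₁).comap (φ.hom ≫ affineBlowup.π _) := by
        rw [← Scheme.IdealSheafData.comap_comp, hφ]
    _ = ((K.comap φ.inv) * affineBlowup.exceptionalIdeal (Ideal.span (Set.range x)) ^ d).comap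
          φ.hom := by
        rw [Scheme.IdealSheafData.comap_comp, hJ₁]
    _ = K * P.comap p ^ d := by rw [comap_mul, comap_pow, hKK, hE]

end Transport

/-! ## Pushforward of ideal sheaves and restriction to opens of the target -/

section MapRestrict

variable {X Y : Scheme.{u}}

/-- **Pushforward of ideal sheaves commutes with restriction to an open of the target**: for
`f : X → Y` quasi-compact, an ideal sheaf `𝓘` on `X` and an open `U ⊆ Y`,
`(f|_U)_*(𝓘|_{f⁻¹U}) ∩ 𝒪_U = (f_*𝓘 ∩ 𝒪_Y)|_U` (Mathlib's `map` is the kernel of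
`𝒪 → f_*𝒪_{V(𝓘)}`, and kernels of quasi-compact morphisms commute with restriction,
`ker_ideal_of_isPullback_of_isOpenImmersion`). [folklore] -/
theorem map_morphismRestrict_eq_comap (f : X ⟶ Y) [QuasiCompact f] (I : X.IdealSheafData)
    (U : Y.Opens) : (I.comap (f ⁻¹ᵁ U).ι).map (f ∣_ U) = (I.map f).comap U.ι := by
  let iU : (I.comap (f ⁻¹ᵁ U).ι).subscheme ⟶ I.subscheme :=
    (I.comapIso (f ⁻¹ᵁ U).ι).hom ≫ pullback.snd _ _
  have sqA : IsPullback (I.comap (f ⁻¹ᵁ U).ι).subschemeι iU (f ⁻¹ᵁ U).ι I.subschemeι :=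
    IsPullback.of_iso_pullback ⟨by simp [iU]⟩ (I.comapIso (f ⁻¹ᵁ U).ι)
      (by simp) (by simp [iU])
  have H : IsPullback ((I.comap (f ⁻¹ᵁ U).ι).subschemeι ≫ f ∣_ U) iU U.ι (I.subschemeι ≫ f) :=
    sqA.paste_horiz (isPullback_morphismRestrict f U)
  apply Scheme.IdealSheafData.ext
  funext W
  change ((I.comap (f ⁻¹ᵁ U).ι).subschemeι ≫ f ∣_ U).ker.ideal W = _
  rw [Scheme.IdealSheafData.ideal_comap_of_isOpenImmersion,
    Scheme.ker_ideal_of_isPullback_of_isOpenImmersion (I.subschemeι ≫ f) _ iU U.ι H W]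
  rfl

/-- Transport of an inequality of section ideals along an equality of affine opens. [folklore] -/
theorem ideal_le_ideal_of_eq {I J : X.IdealSheafData} {U₁ U₂ : X.affineOpens} (h : U₁ = U₂)
    (hle : I.ideal U₁ ≤ J.ideal U₁) : I.ideal U₂ ≤ J.ideal U₂ := by
  subst h
  exact hle

/-- **An inequality of ideal sheaves is local on an open cover.** [folklore] -/
theorem le_of_forall_comap_ι_le {I J : X.IdealSheafData} {ι : Type*} (V : ι → X.Opens)
    (hV : ⨆ i, V i = ⊤) (h : ∀ i, I.comap (V i).ι ≤ J.comap (V i).ι) : I ≤ J := by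
  refine Scheme.IdealSheafData.le_of_iSup_eq_top
    (fun W : {W : X.affineOpens // ∃ i, (W : X.Opens) ≤ V i} => W.1) ?_ ?_
  · refine top_le_iff.mp fun x _ => ?_
    have hx : x ∈ (⨆ i, V i) := by rw [hV]; trivial
    obtain ⟨i, hi⟩ := Opens.mem_iSup.mp hx
    obtain ⟨W, hW, hxW, hWV⟩ := exists_isAffineOpen_mem_and_subset (X := X) (x := x) (U := V i) hi
    exact Opens.mem_iSup.mpr ⟨⟨⟨W, hW⟩, i, hWV⟩, hxW⟩
  · rintro ⟨W, i, hWi⟩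
    have hWr : (W : X.Opens) ≤ (V i).ι.opensRange := by rwa [Scheme.Opens.opensRange_ι]
    let W' : (V i : Scheme.{u}).affineOpens := ⟨(V i).ι ⁻¹ᵁ W, W.2.preimage_of_isOpenImmersion _ hWr⟩
    have e₁ : (V i).ι ''ᵁ (W' : (V i : Scheme.{u}).Opens) = W := by
      change (V i).ι ''ᵁ ((V i).ι ⁻¹ᵁ W) = W
      rw [Scheme.Hom.image_preimage_eq_opensRange_inf, inf_eq_right.mpr hWr]
    have e₂ : (⟨(V i).ι ''ᵁ (W' : (V i : Scheme.{u}).Opens), W'.2.image_of_isOpenImmersion _⟩ :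
        X.affineOpens) = W := Subtype.ext e₁
    have key := h i W'
    rw [Scheme.IdealSheafData.ideal_comap_of_isOpenImmersion,
      Scheme.IdealSheafData.ideal_comap_of_isOpenImmersion] at key
    have hsurj : Function.Surjective ((V i).ι.appIso (W' : (V i : Scheme.{u}).Opens)).inv.hom :=
      ((V i).ι.appIso _).symm.commRingCatIsoToRingEquiv.surjective
    have key' := Ideal.map_mono (f := ((V i).ι.appIso (W' : (V i : Scheme.{u}).Opens)).inv.hom) key
    rw [Ideal.map_comap_of_surjective _ hsurj, Ideal.map_comap_of_surjective _ hsurj] at key'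
    exact ideal_le_ideal_of_eq e₂ key'

end MapRestrict

/-! ## Globalization over a Noetherian base -/

section Global

/-- **Relative ampleness of the exceptional divisor of a blowing up of a Noetherian scheme**
(the displayed formula `b⁻¹𝓙 𝒪_{X'} = 𝓘_E^d 𝓘_{Z'}` of the proof of Stacks, Tag 080B, in the
Noetherian case, with `𝓙 := b_*(𝓘_E^d 𝓘_{Z'}) ∩ 𝒪_X`): if `p : Y' → Y` is a blowing up of the
Noetherian scheme `Y` along `P`, with exceptional ideal `𝓘_E = p⁻¹P 𝒪_{Y'}`, then for every
ideal sheaf `𝓚` on `Y'` there are `d` and an ideal sheaf `𝓠` on `Y` with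
`p⁻¹𝓠 𝒪_{Y'} = 𝓚 · 𝓘_E^d`. Proof: over the members of a finite affine open cover of `Y` by
`IsBlowup.exists_comap_eq_mul_pow_of_isAffine`, with a common `d` (twisting by further powers
of `P`); the local solutions are dominated by the restrictions of `𝓠 = p_*(𝓚 𝓘_E^d) ∩ 𝒪_Y`
(`map_morphismRestrict_eq_comap`), so that `p⁻¹𝓠 𝒪_{Y'} ⊇ 𝓚 𝓘_E^d` locally, hence globally.
[cite: StacksProject, Tag 080B (proof)] -/
theorem IsBlowup.exists_comap_eq_mul_pow {Y' Y : Scheme.{u}} [IsNoetherian Y] {p : Y' ⟶ Y}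
    {P : Y.IdealSheafData} (hp : IsBlowup p P) (K : Y'.IdealSheafData) :
    ∃ (d : ℕ) (Q : Y.IdealSheafData), Q.comap p = K * P.comap p ^ d := by
  haveI : IsProper p := hp.isProper
  haveI : IsLocallyNoetherian Y' := LocallyOfFiniteType.isLocallyNoetherian p
  -- a finite affine open cover of `Y`
  let 𝒰 := Y.affineCover.finiteSubcover
  let U : 𝒰.I₀ → Y.Opens := fun i => (𝒰.f i).opensRange
  have hU : ⨆ i, U i = ⊤ := 𝒰.iSup_opensRange
  haveI : ∀ i, IsAffine (U i : Scheme.{u}) := fun i => isAffineOpen_opensRange (𝒰.f i)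
  -- local solutions
  have hloc : ∀ i, ∃ (d : ℕ) (Q : (U i : Scheme.{u}).IdealSheafData),
      Q.comap (p ∣_ U i) = K.comap (p ⁻¹ᵁ U i).ι * (P.comap (U i).ι).comap (p ∣_ U i) ^ d :=
    fun i => (hp.restrict (U i)).exists_comap_eq_mul_pow_of_isAffine
      (fun W => haveI := IsLocallyNoetherian.component_noetherian W; IsNoetherian.noetherian _) _
      (fun W => haveI := IsLocallyNoetherian.component_noetherian W; IsNoetherian.noetherian _)
  choose d Q hQ using hloc
  -- a common exponent
  let d₀ : ℕ := ∑ i, d i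
  have hd₀ : ∀ i, d i ≤ d₀ := fun i => Finset.single_le_sum (fun j _ => Nat.zero_le (d j))
    (Finset.mem_univ i)
  have hQ' : ∀ i, (Q i * P.comap (U i).ι ^ (d₀ - d i)).comap (p ∣_ U i) =
      (K * P.comap p ^ d₀).comap (p ⁻¹ᵁ U i).ι := fun i => by
    rw [comap_mul, comap_pow, hQ i, comap_mul, comap_pow, mul_assoc, ← pow_add,
      Nat.add_sub_cancel' (hd₀ i), ← Scheme.IdealSheafData.comap_comp,
      ← Scheme.IdealSheafData.comap_comp, morphismRestrict_ι]
  -- the global candidate dominates the local solutions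
  refine ⟨d₀, (K * P.comap p ^ d₀).map p, le_antisymm (Scheme.IdealSheafData.comap_map_le _ _) ?_⟩
  refine le_of_forall_comap_ι_le (fun i => p ⁻¹ᵁ U i) (p.iSup_preimage_eq_top hU) fun i => ?_
  rw [← Scheme.IdealSheafData.comap_comp, ← morphismRestrict_ι, Scheme.IdealSheafData.comap_comp,
    ← map_morphismRestrict_eq_comap, ← hQ']
  exact Scheme.IdealSheafData.comap_mono _ (Scheme.IdealSheafData.le_map_iff_comap_le.mpr le_rfl)

end Global

/-! ## Composition of blowing ups (Raynaud; Temkin 2008, Lemma 2.1.4; Stacks 080B) -/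

section Composition

/-- **A composition of blowing ups of a Noetherian scheme is a blowing up** (Stacks, Tag 080B,
Noetherian case: "Let `b : X' → X` be the blowing up with center `Z`. Let `Z' ⊂ X'` be a closed
subscheme … Let `X'' → X'` be the blowing up with center `Z'`. There exists a closed subscheme
`Y ⊂ X` … such that (1) `Y = Z ∪ b(Z')` set theoretically, and (2) the composition `X'' → X` is
isomorphic to the blowing up of `X` in `Y`"; here with the inclusion `Supp Q ⊆ Supp P ∪ p(Supp P')`
of (1)). Proof as in Stacks: `p⁻¹𝓡 𝒪_{Y'} = 𝓟' · 𝓘_E^d` (`IsBlowup.exists_comap_eq_mul_pow`),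
so `p'` is the blowing up of `Y'` along `p⁻¹𝓡 𝒪_{Y'}` (twist, `IsBlowup.mul_of_isEffectiveCartier`)
and `p' ≫ p` that of `Y` along `𝓟 · 𝓡` (Tag 080A, `IsBlowup.comp`); off `Supp 𝓟` the map `p` is
an isomorphism, under which `Supp 𝓡` corresponds to `Supp 𝓟'`. [cite: StacksProject, Tag 080B] -/
theorem IsBlowup.exists_isBlowup_comp {Y'' Y' Y : Scheme.{u}} [IsNoetherian Y] {p : Y' ⟶ Y}
    {P : Y.IdealSheafData} {p' : Y'' ⟶ Y'} {P' : Y'.IdealSheafData} (hp : IsBlowup p P)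
    (hp' : IsBlowup p' P') :
    ∃ Q : Y.IdealSheafData, IsBlowup (p' ≫ p) Q ∧
      (Q.support : Set Y) ⊆ P.support ∪ p '' (P'.support : Set Y') := by
  obtain ⟨d, R, hR⟩ := hp.exists_comap_eq_mul_pow P'
  have hp'' : IsBlowup p' (R.comap p) := by
    rw [hR]
    exact hp'.mul_of_isEffectiveCartier (hp.isEffectiveCartier.pow d)
  refine ⟨P * R, hp.comp hp'', ?_⟩
  rintro y (hy | hy)
  · exact Or.inl hy
  by_cases hyP : y ∈ (P.support : Set Y)
  · exact Or.inl hyP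
  right
  -- over the complement of `Supp P`, `p` is an isomorphism: lift `y` to `y' ∈ Y'`
  let U : Y.Opens := ⟨(P.support : Set Y)ᶜ, P.support.isClosed.isOpen_compl⟩
  haveI : IsIso (p ∣_ U) := hp.isIso_compl
  obtain ⟨z, hz⟩ := (ConcreteCategory.bijective_of_isIso (p ∣_ U).base).2 ⟨y, hyP⟩
  let y' : Y' := (p ⁻¹ᵁ U).ι z
  have hy' : p y' = y := by
    have := morphismRestrict_base_coe p U z
    rw [hz] at this
    exact this.symm
  refine ⟨y', ?_, hy'⟩
  -- `y'` lies in `Supp (p⁻¹R) = Supp P' ∪ Supp 𝓘_E^d` but not in `Supp 𝓘_E = p⁻¹ Supp P`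
  have h1 : y' ∈ ((R.comap p).support : Set Y') := by
    rw [Scheme.IdealSheafData.support_comap]
    change p y' ∈ (R.support : Set Y)
    rw [hy']
    exact hy
  rw [hR, Scheme.IdealSheafData.support_mul] at h1
  rcases h1 with h1 | h1
  · exact h1
  · exfalso
    apply hyP
    rw [← hy']
    have h2 : y' ∈ ((P.comap p).support : Set Y') := by
      rcases Nat.eq_zero_or_pos d with rfl | hd
      · rw [pow_zero, Scheme.IdealSheafData.one_eq_top, Scheme.IdealSheafData.support_top] at h1
        exact h1.elim
      · rwa [Scheme.IdealSheafData.support_pow _ _ hd.ne'] at h1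
    rw [Scheme.IdealSheafData.support_comap] at h2
    exact h2

/-- **Temkin 2008, Lemma 2.1.4 (Raynaud), two blow-ups of a Noetherian scheme**: "If `X` is
coherent, `V ↪ X` is open and `T = X ∖ V`, then a composition of `V`-admissible (or
`T`-supported) blow ups is a `V`-admissible (or `T`-supported) blow up" — here for `X = Y`
Noetherian, a `T`-supported blow-up `p` (`Supp P ⊆ T`) followed by a `T`-supported blow-up
`p'` of the `Y`-scheme `Y'` (`Supp P' ⊆ p⁻¹(T)`): the composite is a blow-up of `Y` along an
ideal supported in `T`. This is exactly the hypothesis `hcomp` of `temkin2008_prop234_of_comp`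
(`Temkin2008LocalizationProofs.lean`). [cite: Temkin2008, Lemma 2.1.4] -/
theorem IsBlowup.exists_isBlowup_comp_supported {Y'' Y' Y : Scheme.{u}} [IsNoetherian Y]
    (p : Y' ⟶ Y) (P : Y.IdealSheafData) (p' : Y'' ⟶ Y') (P' : Y'.IdealSheafData) (T : Set Y)
    (hp : IsBlowup p P) (hPT : (P.support : Set Y) ⊆ T) (hp' : IsBlowup p' P')
    (hP'T : (P'.support : Set Y') ⊆ p ⁻¹' T) :
    ∃ Q : Y.IdealSheafData, IsBlowup (p' ≫ p) Q ∧ (Q.support : Set Y) ⊆ T := by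
  obtain ⟨Q, hQ, hsupp⟩ := hp.exists_isBlowup_comp hp'
  exact ⟨Q, hQ, hsupp.trans (Set.union_subset hPT (Set.image_subset_iff.mpr hP'T))⟩

end Composition

end Literature.AlgebraicGeometry.Resolution

end
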